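import Summits.AtomisticToContinuum.HydrodynamicLimit.Theses.InformationPercolationEngine
import Summits.AtomisticToContinuum.HydrodynamicLimit.Theorems.ImplosionDichotomyHydroLimitInBandCore
import Summits.AtomisticToContinuum.HydrodynamicLimit.Theorems.ImplosionDichotomyHydroLimitInBandEquilibrium
import Summits.AtomisticToContinuum.HydrodynamicLimit.Theorems.DenseExcursion.Negative.Untied
import Summits.AtomisticToContinuum.HydrodynamicLimit.Theorems.LocalSecondLaw.Negative.HomogeneousLLN
import Summits.AtomisticToContinuum.HydrodynamicLimit.Theorems.KineticWindowGronwall.Negative.ConsequentLoadBearing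

/-!
# Disproof of `InformationPercolationEngine.ChaosClosesEuler` (stmt-AtomisticToContinuum-15141) — findings

Standing disprover's work file (refuter-cdisprove-stmt-AtomisticToContinuum-15141-0; cycle 1, 2026-08-16).
Everything below is kernel-checked; there is no `sorry` at this revision.  The landable part (§1, §3) is
proposed as `Theorems/ChaosClosesEuler/Negative/Structure.lean` (namespace `…Theorems.ChaosClosesEulerNegative`).

VERDICT OF CYCLE 1 — **no kill; no kill by witness is possible.**  The crux is
`ContactChaos → CollisionRate → LocalSecondLaw → HydroLimitInBand`, the conclusion being VERBATIM the
packing-guarded conjunct `ImplosionDichotomy.HydroLimitInBand` (stmt-9133, `hydroLimitInBand_iff_item9133`).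

* §1 STRUCTURE.  `chaosClosesEuler_of_hydroLimitInBand`, `hydroLimitInBand_of_hydrodynamicLimit` (tree),
  `not_hydrodynamicLimit_of_not_chaosClosesEuler`: an unconditional refutation of the crux refutes the summit
  conjunct.  `not_chaosClosesEuler_iff(_pinned)`: `¬crux` is EXACTLY "the three open-problem antecedents hold
  AND some pinned classical hs-Euler solution in the band fails the LLN before its first shock through every
  flow family" (pinned-data core of 9133, tree).  A refuted antecedent makes the crux trivially true
  (`chaosClosesEuler_of_not_*`), so the node can only die MISSTATED (an antecedent too weak for the dock — the
  fate of KineticClosure 13482), never by a counterexample.  The recorded glue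
  `CollisionMomentBound → KineticDock → ChaosClosesEuler` is pure logic (`chaosClosesEuler_of_kineticDock`).
* §2 FRAME.  `frame_inhabited`: at every small `σ` flows exist (Alexander, tree), the local Gibbs laws are
  probability measures, the constant state `(1,0,1)` is a classical solution in the band `σ³ < 1`, and it IS tied
  to the homogeneous data `(1,1,0)` (identified `t = 0` LLN, tree) — no vacuity on either side.
* §3 LOAD-BEARING HYPOTHESES OF THE CONCLUSION.  `conclusion_false_without_tie` (two constant states with
  temperatures `1`, `2`: the conserved empirical energy cannot converge to `3/2` and `3`) and
  `conclusion_false_noPDE` (balance laws deleted, smoothness/positivity/tie/guard kept: the heating state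
  `(1,0,1+t)` is tied and would attract the energy to `9/4` at `t = 1/2` against `3/2`).  Dropping the guard or
  the smallness of `σ` gives `HydrodynamicLimit`-strength statements (open; not attackable).
* §4 EQUILIBRIUM IS CONSISTENT.  For constant profiles the conclusion's inner statement is a THEOREM of the
  tree (`HydroLimitInBandEquilibrium.hydroLimitInBand_inner_const`: Gibbs invariance + classical uniqueness in
  the band), re-exported as `conclusion_inner_rung0`; so every witness against the conclusion is a
  NON-equilibrium profile with a genuine pre-shock failure of hydrodynamics — summit-level negative evidence,
  out of reach of small models, degenerate parameters or kit numerics (none were run: nothing decidable or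
  numerically accessible is asserted by the crux beyond its open antecedents).
* §5 LINE `Sketch` (lead prover-line-stmt-AtomisticToContinuum-15141-0, 7 stubs; no `targets` handed over):
  paper audit of the four "provable now" stubs finds them correctly typed (constants re-derived); the two tail
  stubs are the filed items 13087 / 15144, in fixed-tolerance currency and immune to the one-fast-sphere
  witness that killed 14607; the heart `stub_kineticDock` inherits §1.  Details in the closing docblock.

ATTACKS TRIED (census): degenerate parameters (`T ≤ 0`, `N = 0`, empty flow type — all vacuous-true, never
false); junk audit of the conclusion (`hsCompressibility` junk branch excluded by the guard + HsEosLowDensity;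
`TendstoHydroFieldsAt` events need no measurability; laws are probability measures for `σ ≤ 1/2`); antecedent
falsity at equilibrium (would make the crux vacuous, not false: ContactChaos / CollisionRate need collision-sum
LLNs not in tree, LocalSecondLaw's equilibrium instance is its own disprover's tightness programme, 13081
`Negative/`); negatives index (15 entries; 9168 untied frame, 9236/9238 limit order, 14607 cubic tails — none
bites: tie present, `∃r₀ ∀r ∃N₀ ∀N` order, no tail currency in the crux); barrier catalogue
(BoltzmannHypothesis, HighMomentumCutoff — concern the antecedents / the tail stub 15144, not the dock's logic).
-/

noncomputable section

namespace Summit.AtomisticToContinuum.HydrodynamicLimit.Cruxes.ChaosClosesEuler.Disproof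

open MeasureTheory Filter Set Topology
open scoped ENNReal
open Literature.MathematicalPhysics.KineticTheory Literature.Analysis.FluidPDE
open Summit.AtomisticToContinuum.HydrodynamicLimit.Theses.InformationPercolationEngine
open Summit.AtomisticToContinuum.HydrodynamicLimit.Theorems.DenseExcursionUntied (isHardSphereEulerSolution_const)
open Summit.AtomisticToContinuum.HydrodynamicLimit.Theorems.LocalSecondLawNegative (homogeneous_lln_identified)
open Summit.AtomisticToContinuum.HydrodynamicLimit.Theorems.PolynomialCompressionPDE (Flows flows_nonempty)
open Summit.AtomisticToContinuum.HydrodynamicLimit.Theorems.KineticWindowGronwallNegative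
  (tendstoHydroFieldsAt_congr_slices ramp isSmoothSpaceTimeOn_ramp)
open Summit.AtomisticToContinuum.HydrodynamicLimit.Theorems (HydroLimitInBandCore.not_hydroLimitInBand_iff_pinned
  HydroLimitInBandEquilibrium.hydroLimitInBand_inner_const)

/-! ## §0 The conclusion, named -/

/-- The crux's conclusion, VERBATIM the packing-guarded conjunct `HydroLimitInBand` (stmt-9133). -/
def HydroLimitInBand : Prop :=
  ∃ η₀ : ℝ, 0 < η₀ ∧ ∀ (a₀ θ₀ : T3 → ℝ) (u₀ : T3 → V3), Continuous a₀ → Continuous θ₀ → Continuous u₀ →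
    (∀ x, 0 < a₀ x) → (∀ x, 0 < θ₀ x) → ∃ σ₀ : ℝ, 0 < σ₀ ∧ ∀ σ : ℝ, 0 < σ → σ < σ₀ →
    ∀ (T : ℝ) (ρ θ : ℝ → T3 → ℝ) (u : ℝ → T3 → V3), IsHardSphereEulerSolution σ T ρ u θ →
    (∀ t ∈ Set.Ico 0 T, ∀ x, ρ t x * σ ^ 3 < η₀) →
    ∀ Φ : (N : ℕ) → HardSphereFlow (Torus.geometry (Fin 3)) (hsDiameter σ N) (N + 1),
    TendstoHydroFieldsAt (fun N => localGibbsLaw σ a₀ u₀ θ₀ N (Φ N)) Φ ρ u θ 0 →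
    ∀ t ∈ Set.Ico 0 T, TendstoHydroFieldsAt (fun N => localGibbsLaw σ a₀ u₀ θ₀ N (Φ N)) Φ ρ u θ t

/-- The crux is its three antecedents implying `HydroLimitInBand` (definitional). -/
theorem chaosClosesEuler_iff :
    ChaosClosesEuler ↔ (ContactChaos → CollisionRate → LocalSecondLaw → HydroLimitInBand) :=
  Iff.rfl

/-- The conclusion IS the shared item stmt-9133 (`ImplosionDichotomy.HydroLimitInBand`), definitionally — so
every piece of 9133 knowledge in the tree (pinned core, flow independence, equilibrium instance) applies. -/
theorem hydroLimitInBand_iff_item9133 :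
    HydroLimitInBand ↔ Summit.AtomisticToContinuum.HydrodynamicLimit.Theses.ImplosionDichotomy.HydroLimitInBand :=
  Iff.rfl

/-! ## §1 Structure: what a refutation of the crux would be -/

/-- The conclusion alone proves the crux (the antecedents are then decoration). -/
theorem chaosClosesEuler_of_hydroLimitInBand (h : HydroLimitInBand) : ChaosClosesEuler :=
  fun _ _ _ => h

/-- The sub-problem statement implies the guarded conjunct (tree: `η₀ := 1`, guard ignored). -/
theorem hydroLimitInBand_of_hydrodynamicLimit (h : _root_.HydrodynamicLimit) : HydroLimitInBand :=
  Summit.AtomisticToContinuum.HydrodynamicLimit.Theorems.hydroLimitInBand_of_hydrodynamicLimit h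

/-- **A refutation of the crux refutes the summit conjunct `HydrodynamicLimit`.** -/
theorem not_hydrodynamicLimit_of_not_chaosClosesEuler (h : ¬ChaosClosesEuler) :
    ¬_root_.HydrodynamicLimit :=
  fun H => h (chaosClosesEuler_of_hydroLimitInBand (hydroLimitInBand_of_hydrodynamicLimit H))

/-- **`¬ChaosClosesEuler` unfolded**: the three antecedents (open-problem cruxes 13477, 13481, 13081) hold and
the guarded conjunct fails. -/
theorem not_chaosClosesEuler_iff :
    ¬ChaosClosesEuler ↔ (ContactChaos ∧ CollisionRate ∧ LocalSecondLaw ∧ ¬HydroLimitInBand) := by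
  rw [chaosClosesEuler_iff, Classical.not_imp, Classical.not_imp, Classical.not_imp]

/-- **The refutation obligation in pinned form** (via `HydroLimitInBandCore.not_hydroLimitInBand_iff_pinned`):
besides PROVING averaged chaos at contact, the Enskog rate and the local second law, a disprover must exhibit,
for every guard `η₀`, profiles and arbitrarily small `σ` with a classical hs-Euler solution from the PINNED data
staying in the band whose law of large numbers fails at some `t < T` through every flow family. -/
theorem not_chaosClosesEuler_iff_pinned :
    ¬ChaosClosesEuler ↔ (ContactChaos ∧ CollisionRate ∧ LocalSecondLaw ∧
      ∀ η₀ : ℝ, 0 < η₀ → ∃ (a₀ θ₀ : T3 → ℝ) (u₀ : T3 → V3) (ha : Continuous a₀) (ha0 : ∀ x, 0 < a₀ x),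
        Continuous θ₀ ∧ Continuous u₀ ∧ (∀ x, 0 < θ₀ x) ∧
        ∀ σ₀ : ℝ, 0 < σ₀ → ∃ σ : ℝ, 0 < σ ∧ σ < σ₀ ∧
          ∃ (T : ℝ) (ρ θ : ℝ → T3 → ℝ) (u : ℝ → T3 → V3), IsHardSphereEulerSolution σ T ρ u θ ∧
            ρ 0 = rhoLim (profileOf a₀ ha ha0) σ ∧ u 0 = u₀ ∧ θ 0 = θ₀ ∧
            (∀ t ∈ Ico 0 T, ∀ x, ρ t x * σ ^ 3 < η₀) ∧
            ∀ Φ : Flows σ, ∃ t ∈ Ico 0 T,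
              ¬ TendstoHydroFieldsAt (fun N => localGibbsLaw σ a₀ u₀ θ₀ N (Φ N)) Φ ρ u θ t) := by
  rw [not_chaosClosesEuler_iff, hydroLimitInBand_iff_item9133, HydroLimitInBandCore.not_hydroLimitInBand_iff_pinned]

/-- Vacuity dichotomy (i): a refutation of `ContactChaos` makes the crux trivially true. -/
theorem chaosClosesEuler_of_not_contactChaos (h : ¬ContactChaos) : ChaosClosesEuler :=
  fun hC _ _ => absurd hC h

/-- Vacuity dichotomy (ii): a refutation of `CollisionRate` makes the crux trivially true. -/
theorem chaosClosesEuler_of_not_collisionRate (h : ¬CollisionRate) : ChaosClosesEuler :=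
  fun _ hR _ => absurd hR h

/-- Vacuity dichotomy (iii): a refutation of `LocalSecondLaw` makes the crux trivially true. -/
theorem chaosClosesEuler_of_not_localSecondLaw (h : ¬LocalSecondLaw) : ChaosClosesEuler :=
  fun _ _ hL => absurd hL h

/-- The recorded two-layer glue is pure logic: the dock WITH the tail antecedent (`KineticDock`, the crux's
first stub) and the tail input `CollisionMomentBound` (support stmt-15144) give the crux. -/
theorem chaosClosesEuler_of_kineticDock
    (hDock : ContactChaos → CollisionRate → LocalSecondLaw → CollisionMomentBound → HydroLimitInBand)
    (hTail : CollisionMomentBound) : ChaosClosesEuler :=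
  fun hC hR hL => hDock hC hR hL hTail

/-! ## §2 The frame is inhabited (no vacuity on either side) -/

/-- At every small `σ`: flows exist (Alexander), the local Gibbs laws of the homogeneous data `(1,1,0)` are
probability measures, the constant state `(1,0,1)` is a classical hs-Euler solution on `[0,1)` in the band
`ρσ³ < 1`, and it IS tied to the data at `t = 0` (identified LLN, `homogeneous_lln_identified`).  So the
conclusion's hypotheses are jointly satisfiable by a genuine instance. -/
theorem frame_inhabited :
    ∃ σ₁ : ℝ, 0 < σ₁ ∧ ∀ σ : ℝ, 0 < σ → σ < σ₁ →
      IsHardSphereEulerSolution σ 1 (fun _ _ => 1) (fun _ _ => 0) (fun _ _ => 1) ∧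
      (∀ t ∈ Set.Ico (0 : ℝ) 1, ∀ x : T3, (fun (_ : ℝ) (_ : T3) => (1 : ℝ)) t x * σ ^ 3 < 1) ∧
      Nonempty (Flows σ) ∧
      ∀ Φ : Flows σ,
        (∀ N, IsProbabilityMeasure (localGibbsLaw σ (fun _ => 1) (fun _ => 0) (fun _ => 1) N (Φ N))) ∧
        TendstoHydroFieldsAt (fun N => localGibbsLaw σ (fun _ => 1) (fun _ => 0) (fun _ => 1) N (Φ N)) Φ
          (fun _ _ => (1 : ℝ)) (fun _ _ => (0 : V3)) (fun _ _ => (1 : ℝ)) 0 := by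
  obtain ⟨σ₁, hσ₁, hσ₁h, H⟩ := homogeneous_lln_identified one_pos
  refine ⟨σ₁, hσ₁, fun σ hσ hσlt => ?_⟩
  have hσ2 : σ < 1 / 2 := lt_of_lt_of_le hσlt hσ₁h
  refine ⟨isHardSphereEulerSolution_const σ 1 0 one_pos one_pos, fun t _ x => ?_, flows_nonempty hσ hσ2,
    fun Φ => ⟨fun N => ?_, H σ hσ hσlt Φ⟩⟩
  · have h1 : σ < 1 := by linarith
    have : σ ^ 3 < 1 ^ 3 := by gcongr
    simpa using this
  · exact isProbabilityMeasure_localGibbsLaw (a₀ := fun _ => (1 : ℝ)) (θ₀ := fun _ => (1 : ℝ))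
      (u₀ := fun _ => (0 : V3)) continuous_const continuous_const continuous_const
      (fun _ => one_pos) (fun _ => one_pos) hσ2.le N (Φ N)

/-! ## §3a The `t = 0` tie is load-bearing in the conclusion -/

/-- Limits in probability are unique (laws of total mass `1`). [folklore] -/
theorem limit_unique {Ω : ℕ → Type*} [∀ N, MeasurableSpace (Ω N)]
    {P : (N : ℕ) → Measure (Ω N)} (hP : ∀ N, P N Set.univ = 1) {F : (N : ℕ) → Ω N → ℝ} {a b : ℝ}
    (ha : ∀ δ > (0 : ℝ), Tendsto (fun N => P N {z | δ < |F N z - a|}) atTop (𝓝 0))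
    (hb : ∀ δ > (0 : ℝ), Tendsto (fun N => P N {z | δ < |F N z - b|}) atTop (𝓝 0)) : a = b := by
  by_contra hne
  have hab : 0 < |a - b| := abs_pos.2 (sub_ne_zero.2 hne)
  have hle : ∀ N, (1 : ℝ≥0∞) ≤
      P N {z | |a - b| / 3 < |F N z - a|} + P N {z | |a - b| / 3 < |F N z - b|} := by
    intro N
    rw [← hP N]
    refine (measure_mono fun z _ => ?_).trans (measure_union_le _ _)
    by_contra hz
    simp only [Set.mem_union, Set.mem_setOf_eq, not_or, not_lt] at hz
    have h1 : |a - b| ≤ |F N z - a| + |F N z - b| := by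
      calc |a - b| = |(F N z - b) - (F N z - a)| := by ring_nf
        _ ≤ |F N z - b| + |F N z - a| := abs_sub _ _
        _ = |F N z - a| + |F N z - b| := add_comm _ _
    linarith [hz.1, hz.2]
  have h0 : Tendsto (fun N => P N {z | |a - b| / 3 < |F N z - a|} +
      P N {z | |a - b| / 3 < |F N z - b|}) atTop (𝓝 0) := by
    simpa using (ha _ (by positivity)).add (hb _ (by positivity))
  exact absurd (ge_of_tendsto' h0 hle) (by simp)

/-- The total energy of the constant state `(1, 0, c)` tested against `χ ≡ 1` is `3c/2` (unit-volume torus),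
in the syntactic shape produced by `TendstoHydroFieldsAt` for time-constant fields. [folklore] -/
theorem integral_totalEnergyDensity_const (c s : ℝ) :
    ∫ x : T3, (fun _ : T3 => (1 : ℝ)) x * totalEnergyDensity ((fun (_ : ℝ) (_ : T3) => (1 : ℝ)) s x)
      ((fun (_ : ℝ) (_ : T3) => (0 : V3)) s x) ((fun (_ : ℝ) (_ : T3) => c) s x) = 3 / 2 * c := by
  haveI : IsProbabilityMeasure (volume : Measure T3) := by
    rw [volume_pi]; infer_instance
  simp [totalEnergyDensity, integral_const]

/-- A reduced density below three thresholds at once: `σ < σ₀`, `σ < σ₁`, `σ³ < η₀`. [folklore] -/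
theorem exists_small_sigma {σ₀ σ₁ η₀ : ℝ} (hσ₀ : 0 < σ₀) (hσ₁ : 0 < σ₁) (hη₀ : 0 < η₀) :
    ∃ σ : ℝ, 0 < σ ∧ σ < σ₀ ∧ σ < σ₁ ∧ σ ^ 3 < η₀ := by
  set s := min (min σ₀ σ₁) (min η₀ 1) / 2 with hs
  have hm : 0 < min (min σ₀ σ₁) (min η₀ 1) := lt_min (lt_min hσ₀ hσ₁) (lt_min hη₀ one_pos)
  have hs0 : 0 < s := by positivity
  refine ⟨s, hs0, ?_, ?_, ?_⟩
  · linarith [min_le_left (min σ₀ σ₁) (min η₀ 1), min_le_left σ₀ σ₁]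
  · linarith [min_le_left (min σ₀ σ₁) (min η₀ 1), min_le_right σ₀ σ₁]
  · have hs1 : s < 1 := by linarith [min_le_right (min σ₀ σ₁) (min η₀ 1), min_le_right η₀ (1 : ℝ)]
    have hsη : s < η₀ := by linarith [min_le_right (min σ₀ σ₁) (min η₀ 1), min_le_left η₀ (1 : ℝ)]
    calc s ^ 3 ≤ s ^ 1 := pow_le_pow_of_le_one hs0.le hs1.le (by norm_num)
      _ = s := pow_one s
      _ < η₀ := hsη

/-- **The `t = 0` tie is load-bearing**: the crux's conclusion `HydroLimitInBand` with the single hypothesis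
`TendstoHydroFieldsAt … 0 →` DELETED (everything else verbatim) is FALSE.  Witness: profiles `(1,1,0)`,
Alexander flows, the constant classical states `(1,0,1)` and `(1,0,2)` on `[0,1)` (in the band once `σ³ < η₀`),
`t = 0`, test `χ ≡ 1`: the empirical energy would converge in probability to `3/2` and to `3`. [folklore] -/
theorem conclusion_false_without_tie :
    ¬ (∃ η₀ : ℝ, 0 < η₀ ∧ ∀ (a₀ θ₀ : T3 → ℝ) (u₀ : T3 → V3), Continuous a₀ → Continuous θ₀ → Continuous u₀ →
      (∀ x, 0 < a₀ x) → (∀ x, 0 < θ₀ x) → ∃ σ₀ : ℝ, 0 < σ₀ ∧ ∀ σ : ℝ, 0 < σ → σ < σ₀ →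
      ∀ (T : ℝ) (ρ θ : ℝ → T3 → ℝ) (u : ℝ → T3 → V3), IsHardSphereEulerSolution σ T ρ u θ →
      (∀ t ∈ Set.Ico 0 T, ∀ x, ρ t x * σ ^ 3 < η₀) →
      ∀ Φ : (N : ℕ) → HardSphereFlow (Torus.geometry (Fin 3)) (hsDiameter σ N) (N + 1),
      ∀ t ∈ Set.Ico 0 T, TendstoHydroFieldsAt (fun N => localGibbsLaw σ a₀ u₀ θ₀ N (Φ N)) Φ ρ u θ t) := by
  rintro ⟨η₀, hη₀, H⟩
  obtain ⟨σ₀, hσ₀, hσ⟩ := H (fun _ => 1) (fun _ => 1) (fun _ => 0) continuous_const continuous_const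
    continuous_const (fun _ => one_pos) (fun _ => one_pos)
  obtain ⟨σ, hσpos, hσlt0, hσhalf, hσcube⟩ := exists_small_sigma hσ₀ (show (0 : ℝ) < 1 / 2 by norm_num) hη₀
  obtain ⟨Φ⟩ := flows_nonempty hσpos hσhalf
  have hband : ∀ t ∈ Set.Ico (0 : ℝ) 1, ∀ x : T3, (fun (_ : ℝ) (_ : T3) => (1 : ℝ)) t x * σ ^ 3 < η₀ :=
    fun t _ x => by simpa using hσcube
  have h1 := hσ σ hσpos hσlt0 1 (fun _ _ => 1) (fun _ _ => 1) (fun _ _ => 0)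
    (isHardSphereEulerSolution_const σ 1 0 one_pos one_pos) hband Φ 0 ⟨le_rfl, one_pos⟩
  have h2 := hσ σ hσpos hσlt0 1 (fun _ _ => 1) (fun _ _ => 2) (fun _ _ => 0)
    (isHardSphereEulerSolution_const σ 1 0 one_pos two_pos) hband Φ 0 ⟨le_rfl, one_pos⟩
  have hP : ∀ N, localGibbsLaw σ (fun _ => 1) (fun _ => 0) (fun _ => 1) N (Φ N) Set.univ = 1 := by
    intro N
    haveI := isProbabilityMeasure_localGibbsLaw (a₀ := fun _ => (1 : ℝ)) (θ₀ := fun _ => (1 : ℝ))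
      (u₀ := fun _ => (0 : V3)) continuous_const continuous_const continuous_const
      (fun _ => one_pos) (fun _ => one_pos) hσhalf.le N (Φ N)
    exact measure_univ
  have hE : (3 / 2 : ℝ) * 1 = 3 / 2 * 2 := by
    refine limit_unique (P := fun N => localGibbsLaw σ (fun _ => 1) (fun _ => 0) (fun _ => 1) N (Φ N)) hP
      (F := fun N z => empiricalEnergyField ((Φ N).flow 0 z) (fun _ => 1)) (fun δ hδ => ?_) (fun δ hδ => ?_)
    · have h := (h1 (fun _ => 1) continuous_const δ hδ).2.2
      rw [integral_totalEnergyDensity_const 1 0] at h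
      exact h
    · have h := (h2 (fun _ => 1) continuous_const δ hδ).2.2
      rw [integral_totalEnergyDensity_const 2 0] at h
      exact h
  norm_num at hE

/-! ## §3b The Euler balance laws are load-bearing in the conclusion -/

/-- **The Euler balance laws are load-bearing**: the crux's conclusion with `IsHardSphereEulerSolution σ T ρ u θ`
WEAKENED to joint smoothness and positivity of `(ρ, u, θ)` on `[0,T) × 𝕋³` (the three balance laws deleted; the
guard and the `t = 0` tie kept verbatim) is FALSE.  Witness: profiles `(1,1,0)` with the identified `t = 0` LLN
(`homogeneous_lln_identified`), Alexander flows, `T = 1`, the smooth positive heating state `(1, 0, 1 + t)` and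
the constant solution `(1, 0, 1)` — both tied at `t = 0`, both in the band; at `t = 1/2` the empirical energy
would converge in probability to `9/4` and to `3/2`. [folklore] -/
theorem conclusion_false_noPDE :
    ¬ (∃ η₀ : ℝ, 0 < η₀ ∧ ∀ (a₀ θ₀ : T3 → ℝ) (u₀ : T3 → V3), Continuous a₀ → Continuous θ₀ → Continuous u₀ →
      (∀ x, 0 < a₀ x) → (∀ x, 0 < θ₀ x) → ∃ σ₀ : ℝ, 0 < σ₀ ∧ ∀ σ : ℝ, 0 < σ → σ < σ₀ →
      ∀ (T : ℝ) (ρ θ : ℝ → T3 → ℝ) (u : ℝ → T3 → V3),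
      Literature.Analysis.FunctionSpaces.Torus.IsSmoothSpaceTimeOn (Set.Ico 0 T) ρ →
      Literature.Analysis.FunctionSpaces.Torus.IsSmoothSpaceTimeOn (Set.Ico 0 T) u →
      Literature.Analysis.FunctionSpaces.Torus.IsSmoothSpaceTimeOn (Set.Ico 0 T) θ →
      (∀ t ∈ Set.Ico 0 T, ∀ x, 0 < ρ t x) → (∀ t ∈ Set.Ico 0 T, ∀ x, 0 < θ t x) →
      (∀ t ∈ Set.Ico 0 T, ∀ x, ρ t x * σ ^ 3 < η₀) →
      ∀ Φ : (N : ℕ) → HardSphereFlow (Torus.geometry (Fin 3)) (hsDiameter σ N) (N + 1),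
      TendstoHydroFieldsAt (fun N => localGibbsLaw σ a₀ u₀ θ₀ N (Φ N)) Φ ρ u θ 0 →
      ∀ t ∈ Set.Ico 0 T, TendstoHydroFieldsAt (fun N => localGibbsLaw σ a₀ u₀ θ₀ N (Φ N)) Φ ρ u θ t) := by
  rintro ⟨η₀, hη₀, H⟩
  obtain ⟨σ₀, hσ₀, hσ⟩ := H (fun _ => 1) (fun _ => 1) (fun _ => 0) continuous_const continuous_const
    continuous_const (fun _ => one_pos) (fun _ => one_pos)
  obtain ⟨σ₁, hσ₁, hσ₁h, hlln⟩ := homogeneous_lln_identified one_pos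
  obtain ⟨σ, hσpos, hσlt0, hσlt1, hσcube⟩ := exists_small_sigma hσ₀ hσ₁ hη₀
  have hσhalf : σ < 1 / 2 := lt_of_lt_of_le hσlt1 hσ₁h
  obtain ⟨Φ⟩ := flows_nonempty hσpos hσhalf
  have hband : ∀ t ∈ Set.Ico (0 : ℝ) 1, ∀ x : T3, (fun (_ : ℝ) (_ : T3) => (1 : ℝ)) t x * σ ^ 3 < η₀ :=
    fun t _ x => by simpa using hσcube
  have hsol := isHardSphereEulerSolution_const σ 1 (0 : V3) one_pos one_pos
  have h0 : TendstoHydroFieldsAt (fun N => localGibbsLaw σ (fun _ => 1) (fun _ => 0) (fun _ => 1) N (Φ N)) Φ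
      (fun _ _ => (1 : ℝ)) (fun _ _ => (0 : V3)) (fun _ _ => (1 : ℝ)) 0 := hlln σ hσpos hσlt1 Φ
  -- the heating target `(1, 0, 1 + t)`: same time-0 slice, so it is tied as well
  have hramp0 : ramp 0 = (fun (_ : ℝ) (_ : T3) => (1 : ℝ)) 0 := by funext x; simp [ramp]
  have h0' : TendstoHydroFieldsAt (fun N => localGibbsLaw σ (fun _ => 1) (fun _ => 0) (fun _ => 1) N (Φ N)) Φ
      (fun _ _ => (1 : ℝ)) (fun _ _ => (0 : V3)) ramp 0 :=
    (tendstoHydroFieldsAt_congr_slices (ρ := fun _ _ => (1 : ℝ)) (u := fun _ _ => (0 : V3))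
      (θ := ramp) (θ' := fun _ _ => (1 : ℝ)) (t := 0) rfl rfl hramp0).2 h0
  have ht : (1 / 2 : ℝ) ∈ Set.Ico (0 : ℝ) 1 := ⟨by norm_num, by norm_num⟩
  have hpos1 : ∀ t ∈ Set.Ico (0 : ℝ) 1, ∀ x : T3, (0 : ℝ) < (fun (_ : ℝ) (_ : T3) => (1 : ℝ)) t x :=
    fun _ _ _ => one_pos
  have hposr : ∀ t ∈ Set.Ico (0 : ℝ) 1, ∀ x : T3, (0 : ℝ) < ramp t x := fun t ht' x => by
    simp only [ramp]; linarith [ht'.1]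
  have h1 := hσ σ hσpos hσlt0 1 (fun _ _ => 1) (fun _ _ => 1) (fun _ _ => 0) hsol.smooth_density
    hsol.smooth_velocity hsol.smooth_temperature hpos1 hpos1 hband Φ h0 (1 / 2) ht
  have h2 := hσ σ hσpos hσlt0 1 (fun _ _ => 1) ramp (fun _ _ => 0) hsol.smooth_density hsol.smooth_velocity
    (isSmoothSpaceTimeOn_ramp _) hpos1 hposr hband Φ h0' (1 / 2) ht
  -- read the heating statement at `t = 1/2` as the constant state `(1, 0, 3/2)`
  have hramp : ramp (1 / 2) = (fun (_ : ℝ) (_ : T3) => (3 / 2 : ℝ)) (1 / 2) := by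
    funext x; norm_num [ramp]
  have h2' : TendstoHydroFieldsAt (fun N => localGibbsLaw σ (fun _ => 1) (fun _ => 0) (fun _ => 1) N (Φ N)) Φ
      (fun _ _ => (1 : ℝ)) (fun _ _ => (0 : V3)) (fun _ _ => (3 / 2 : ℝ)) (1 / 2) :=
    (tendstoHydroFieldsAt_congr_slices (ρ := fun _ _ => (1 : ℝ)) (u := fun _ _ => (0 : V3))
      (θ := ramp) (θ' := fun _ _ => (3 / 2 : ℝ)) (t := 1 / 2) rfl rfl hramp).1 h2
  have hP : ∀ N, localGibbsLaw σ (fun _ => 1) (fun _ => 0) (fun _ => 1) N (Φ N) Set.univ = 1 := by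
    intro N
    haveI := isProbabilityMeasure_localGibbsLaw (a₀ := fun _ => (1 : ℝ)) (θ₀ := fun _ => (1 : ℝ))
      (u₀ := fun _ => (0 : V3)) continuous_const continuous_const continuous_const
      (fun _ => one_pos) (fun _ => one_pos) hσhalf.le N (Φ N)
    exact measure_univ
  have hE : (3 / 2 : ℝ) * 1 = 3 / 2 * (3 / 2) := by
    refine limit_unique (P := fun N => localGibbsLaw σ (fun _ => 1) (fun _ => 0) (fun _ => 1) N (Φ N)) hP
      (F := fun N z => empiricalEnergyField ((Φ N).flow (1 / 2) z) (fun _ => 1)) (fun δ hδ => ?_)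
      (fun δ hδ => ?_)
    · have h := (h1 (fun _ => 1) continuous_const δ hδ).2.2
      rw [integral_totalEnergyDensity_const 1 (1 / 2)] at h
      exact h
    · have h := (h2' (fun _ => 1) continuous_const δ hδ).2.2
      rw [integral_totalEnergyDensity_const (3 / 2) (1 / 2)] at h
      exact h
  norm_num at hE

/-! ## §4 The equilibrium instance is consistent (cannot witness against the conclusion) -/

/-- **Rung 0 of the conclusion is a theorem** (tree, `HydroLimitInBandEquilibrium.hydroLimitInBand_inner_const`):
for CONSTANT profiles `(a, θc, uc)` there are a guard `η₁` and a threshold `σ₀(a, θc, uc)` such that every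
classical hs-Euler solution in the band tied at `t = 0` propagates the LLN to all `t < T`, for every flow family
(Gibbs invariance of the homogeneous law + classical uniqueness with the analytic EOS).  Hence no equilibrium
instance — the only kind whose `t = 0` tie the tree can compute — is a counterexample to the crux. -/
theorem conclusion_inner_rung0 :
    ∃ η₁ : ℝ, 0 < η₁ ∧ ∀ (a θc : ℝ) (uc : V3), 0 < a → 0 < θc →
      ∃ σ₀ : ℝ, 0 < σ₀ ∧ ∀ σ : ℝ, 0 < σ → σ < σ₀ →
        ∀ (T : ℝ) (ρ θ : ℝ → T3 → ℝ) (u : ℝ → T3 → V3), IsHardSphereEulerSolution σ T ρ u θ →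
          (∀ t ∈ Ico 0 T, ∀ x, ρ t x * σ ^ 3 < η₁) →
          ∀ Φ : Flows σ,
            TendstoHydroFieldsAt
                (fun N => localGibbsLaw σ (fun _ => a) (fun _ => uc) (fun _ => θc) N (Φ N)) Φ ρ u θ 0 →
              ∀ t ∈ Ico 0 T, TendstoHydroFieldsAt
                (fun N => localGibbsLaw σ (fun _ => a) (fun _ => uc) (fun _ => θc) N (Φ N)) Φ ρ u θ t :=
  HydroLimitInBandEquilibrium.hydroLimitInBand_inner_const

/-! ## §5 Line `Sketch` — stub audit (paper; nothing here is a stub kill)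

Targets: none were handed over (`payload.targets = []`, `stuck_stubs = []`).  The seven registered stubs of
`Lines/Sketch.lean` were read against their informal derivations:

* `stub_collisionInvariance` (deterministic Abel bound).  Re-derived: per particle `k` with collisions
  `s₁ < … < s_m` in `[0,τ]`, `∑ₙ χₙ(ψ(vₙ) − ψ(vₙ₋₁)) = χ_m ψ(v_m) − χ₁ ψ(v₀) + ∑_{n<m} (χₙ − χₙ₊₁) ψ(vₙ)`,
  `|·| ≤ 2CχCψ + Cψ Lχ ∑ₙ Δsₙ (1 + |vₙ|) ≤ 2CχCψ + CψLχ ∫₀^τ (1 + |v_k|)`; summing over `k` with the prefactor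
  `ε/(N+1)` and `(N+1)⁻¹∑|v_k| ≤ 1/2 + E/(N+1)` (AM–GM + energy conservation) gives exactly
  `ε Cψ (2Cχ + Lχ τ (3/2 + E/(N+1)))`.  Inputs it silently needs: energy conservation along good orbits
  (`HardSphereFlow.configEnergy_flow`, in tree), `euclidDist (x + sv) x ≤ |v| s` on `𝕋³`, `reflectVel` an
  involution commuting with the swap and with `n ↦ −n`, uniqueness of the contact pair at a collision time
  (`IsHardSphereTrajectory.binary`) so that the double sum has exactly the two ordered terms.  Correctly
  typed; no degenerate case bites (`N = 0`: no collisions, both sides `≥ 0`).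
* `stub_massBalance`.  Holds for every `r > 0` (the guard `r < 1/2` is unnecessary): with
  `G_s(y) := ∫ φ(s,x) b_r(y,x) dx = (φ_s ∗ k_r)(y)` smooth in `(s,y)` (Haar translation invariance of the cone),
  `t ↦ (N+1)⁻¹∑ G_t(xᵢ(t))` is continuous and differentiable off the finitely many collision times with
  derivative the stated integrand; FTC as `intervalIntegral.integral_eq_sub_of_hasDeriv_right_of_le`.
* `stub_initialLayer`.  Follows from the tie ALONE (no Gibbs structure): cones of a finite net as tests,
  `∫ b_r = 1` for `r ≤ 1/2` (tree: `LocalSecondLawNegative` cone normalisation /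
  `DensityCapNegative.integral_cone_left`) + uniform continuity of the `t = 0` slices for the centring,
  `Lip(b_r) = 3/(πr⁴)` times `(mass, (N+1)⁻¹∑|vᵢ| ≤ 1/2 + energy, energy)` for the `x`-modulus, and
  tightness of the energy from the tie with `χ ≡ 1`.  Correctly typed (`∃ r₀` may depend on `η`).
* `stub_bridge`.  `|∫χ(ρ_r − ρ_t)| ≤ ‖χ‖_∞‖ρ_r − ρ_t‖₁` and `|e.d.f.(χ) − ∫χρ_r| ≤ ω_χ(r)` (unit cone mass);
  momentum/energy likewise with the energy tightness; `σ₀ := min σ₀ 2⁻¹` harmless.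
* `stub_kineticEnergyTails` (= item 13087) and `stub_collisionMomentBound` (= item 15144): both in
  fixed-tolerance currency (`E ≤ ε` pointwise in `s`; `P(K_N[1+|v|²+|v_*|²] > K_b) ≤ δ`), so the
  one-fast-sphere witness of 14607 (`|v₀|² ≍ N`) costs `e^{-cN}` and does not bite; a sphere fast enough to
  move `K_N[|v|²]` by `O(1)` in ONE collision needs `|v₀|² ≍ (N+1)^{4/3}/σ`, Gaussian cost `exp(−c N^{4/3})`.
  Both genuinely open (entropy bounds but does not make tails vanish); no cheap kill.
* `stub_kineticDock` (the heart): its conclusion `MollifiedCloseInBand` implies `HydroLimitInBand`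
  (`stub_bridge`), so by §1 no witness short of a failure of hydrodynamics touches it.  One typing remark for
  the lead: `ContactChaos` + `CollisionRate` leave DIRAC local velocity laws (cold spots, zero rate) as
  legitimate collision-balanced states; the dock must price them with the relative energy, not exclude them.
* Joint sufficiency: `ChaosClosesEuler_of` is kernel-checked in the line file; no gap is smuggled.
-/

end Summit.AtomisticToContinuum.HydrodynamicLimit.Cruxes.ChaosClosesEuler.Disproof

end
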